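import Literature.Analysis.FluidPDE.SelfSimilar
import Literature.Analysis.FluidPDE.Vorticity
import Literature.Analysis.FluidPDE.CurlIsometryCovariance
import Literature.Analysis.FluidPDE.PineauVicolEnstrophyIdentity
import HarnessLib

/-!
# Vorticity directions of an exactly rotated-DSS field: Giga–Miura's (CA) self-improves to parallel vorticity

Negative (kernel) lane of route `AngularGalerkinLadder`, crux `NoOverheating` (K2), stratum (S9)
— part 1 of 2 (algebra; consumed by `UnidirectionalVorticityWindowsExcluded`).  Rev 2 (de-cone):
this file is ROUTE-INDEPENDENT algebra — it imports Literature modules only, not the route's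
Theses file, so that importers stay outside the route's rebuild cone; all declarations, statements
and proofs are unchanged. For ONE field with
the exact rotated discrete self-similarity `c Rᵀu(c²t, cRx) = u(t, x)` (`IsRotatedDSS c R u`, the
symmetry of every rung profile of the ladder; no equation is used):

* the slice `u(s)` is the conjugate–rescaling `x ↦ R(c⁻¹ u(s/c²)(c⁻¹R⁻¹x))` of the slice `u(s/c²)`
  (`slice_eq_conj_of_isRotatedDSS`), so by the pseudo-vector law of the curl
  (`curl_conj_linearIsometryEquiv`) `curl u(s)(x) = (det R) c⁻² R curl u(s/c²)(c⁻¹R⁻¹x)`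
  (`curl_slice_eq_of_isRotatedDSS`): across one period vorticity MAGNITUDES scale by `c⁻²`
  (`norm_curl_slice_eq_of_isRotatedDSS`) while vorticity DIRECTIONS `ξ = ω/|ω|`
  (Constantin–Fefferman) are transported isometrically (`vorticityDirection_slice_eq_of_isRotatedDSS`,
  `norm_vorticityDirection_sub_eq_of_isRotatedDSS`);
* unidirectionality `curl u(s) = |curl u(s)| e` propagates from `s/c²` to `s`, hence from the window
  `(−1, 0)` to all `t < 0` when `c > 1` (`unidirectional_of_isRotatedDSS_of_Ioo`);
* **self-improvement of (CA)**: Giga–Miura's continuous-alignment hypothesis on `(−1,0) × ℝ³` —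
  `‖ξ(s,x) − ξ(s,y)‖ ≤ η(‖x − y‖)` wherever `|ω(s,·)| > d`, with ANY threshold `d` and ANY `η` with
  `η(r) → 0` as `r ↓ 0` (Giga–Miura 2011, Theorem 1.3 with Remark 1.4) — holds, after pulling the
  pair of points back `k` periods, with `η(‖x − y‖/cᵏ)` above the threshold `d/c²ᵏ`
  (`continuousAlignment_iterate`); letting `k → ∞`, the directions are exactly parallel on every
  window slice (`vorticityDirection_eq_of_continuousAlignment`) and the vorticity of every slice
  `t < 0` is unidirectional (`unidirectional_of_continuousAlignment`). For an exactly (R)DSS profile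
  (CA) is thus equivalent to parallel vorticity — which Giga–Miura's Proposition 2.2 excludes for the
  ladder limit (part 2).

No new definitions, no new facts; standard axioms.

References: Y. Giga, H. Miura, Comm. Math. Phys. 303 (2011) 289–300, Theorem 1.3, Remark 1.4
[GigaMiura2011]; P. Constantin, C. Fefferman, Indiana Univ. Math. J. 42 (1993) 775–789, §1
[ConstantinFefferman1993]; D. Chae, J. Wolf, Arch. Ration. Mech. Anal. 225 (2017), Def. 1.1
[ChaeWolf2017]; G. Arfken, H. Weber, *Mathematical Methods for Physicists* (1995), §2.9
[ArfkenWeber1995].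
-/

noncomputable section

namespace Summit.NavierStokesRegularity.AngularGalerkinLadderRotatedDSSVorticityDirection

open Set Filter Topology Function
open scoped RealInnerProductSpace
open Literature.Analysis Literature.Analysis.FluidPDE

section Algebra

variable {c : ℝ} {R : EuclideanSpace ℝ (Fin 3) ≃ₗᵢ[ℝ] EuclideanSpace ℝ (Fin 3)}
  {u : ℝ → EuclideanSpace ℝ (Fin 3) → EuclideanSpace ℝ (Fin 3)}

/-- The slice `u(s)` of a rotated-DSS field is the conjugate–rescaling of the slice `u(s/c²)`:
`u(s, x) = R (c⁻¹ u(s/c², c⁻¹ R⁻¹ x))` (the defining relation `c R⁻¹ u(c²t, cRx) = u(t,x)` read at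
`t = s/c²`, `x ↦ c⁻¹R⁻¹x`). [cite: ChaeWolf2017, Def. 1.1] -/
theorem slice_eq_conj_of_isRotatedDSS (h : IsRotatedDSS c R u) (hc : c ≠ 0) (s : ℝ) :
    u s = fun x => R (c⁻¹ • u (s / c ^ 2) (c⁻¹ • R.symm x)) := by
  funext x
  have h1 := h (s / c ^ 2) (c⁻¹ • R.symm x)
  have e1 : c ^ 2 * (s / c ^ 2) = s := by field_simp
  have e2 : c • R (c⁻¹ • R.symm x) = x := by
    rw [LinearIsometryEquiv.map_smul, smul_smul, mul_inv_cancel₀ hc, one_smul,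
      LinearIsometryEquiv.apply_symm_apply]
  rw [e1, e2] at h1
  rw [LinearIsometryEquiv.map_smul, ← h1, LinearIsometryEquiv.map_smul,
    LinearIsometryEquiv.apply_symm_apply, smul_smul, inv_mul_cancel₀ hc, one_smul]

/-- **Vorticity of a rotated-DSS field across one period**:
`curl u(s)(x) = (det R · c⁻²) • R (curl u(s/c²) (c⁻¹R⁻¹x))` — the pseudo-vector law
`curl (R ∘ v ∘ R⁻¹) = det R • R ∘ curl v ∘ R⁻¹` composed with `curl (c⁻¹ v(c⁻¹·)) = c⁻² (curl v)(c⁻¹·)`.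
[cite: ArfkenWeber1995, §2.9 eq. (2.90), (2.97)–(2.99)] -/
theorem curl_slice_eq_of_isRotatedDSS (h : IsRotatedDSS c R u) (hc : c ≠ 0) (s : ℝ)
    (x : EuclideanSpace ℝ (Fin 3)) :
    curl (u s) x =
      ((R : EuclideanSpace ℝ (Fin 3) →L[ℝ] EuclideanSpace ℝ (Fin 3)).det * (c⁻¹) ^ 2) •
        R (curl (u (s / c ^ 2)) (c⁻¹ • R.symm x)) := by
  have key : curl (fun y => R (c⁻¹ • u (s / c ^ 2) (c⁻¹ • R.symm y))) x =
      (R : EuclideanSpace ℝ (Fin 3) →L[ℝ] EuclideanSpace ℝ (Fin 3)).det •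
        R (curl (fun z => c⁻¹ • u (s / c ^ 2) (c⁻¹ • z)) (R.symm x)) :=
    curl_conj_linearIsometryEquiv R (fun z => c⁻¹ • u (s / c ^ 2) (c⁻¹ • z)) x
  rw [slice_eq_conj_of_isRotatedDSS h hc s, key, curl_const_smul_comp_smul,
    LinearIsometryEquiv.map_smul, smul_smul]

/-- The determinant of a linear isometry has absolute value `1`. [cite: ArfkenWeber1995, §3.3 Exercise 3.3.2] -/
theorem abs_det_linearIsometryEquiv (R : EuclideanSpace ℝ (Fin 3) ≃ₗᵢ[ℝ] EuclideanSpace ℝ (Fin 3)) :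
    |(R : EuclideanSpace ℝ (Fin 3) →L[ℝ] EuclideanSpace ℝ (Fin 3)).det| = 1 := by
  rcases det_linearIsometryEquiv_eq_one_or_eq_neg_one R with h1 | h1 <;> rw [h1] <;> norm_num

/-- **Vorticity magnitudes scale by `c⁻²` across one period**:
`‖curl u(s)(x)‖ = c⁻² ‖curl u(s/c²)(c⁻¹R⁻¹x)‖`. [cite: ChaeWolf2017, Def. 1.1] -/
theorem norm_curl_slice_eq_of_isRotatedDSS (h : IsRotatedDSS c R u) (hc : c ≠ 0) (s : ℝ)
    (x : EuclideanSpace ℝ (Fin 3)) :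
    ‖curl (u s) x‖ = (c⁻¹) ^ 2 * ‖curl (u (s / c ^ 2)) (c⁻¹ • R.symm x)‖ := by
  rw [curl_slice_eq_of_isRotatedDSS h hc s x, norm_smul, LinearIsometryEquiv.norm_map,
    Real.norm_eq_abs, abs_mul, abs_det_linearIsometryEquiv, one_mul, abs_of_nonneg (sq_nonneg _)]

/-- **Vorticity directions are transported isometrically across one period**:
`ξ(s)(x) = det R • R ξ(s/c²)(c⁻¹R⁻¹x)` (`ξ = ω/|ω|`, Constantin–Fefferman's direction field).
[cite: ConstantinFefferman1993, §1] -/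
theorem vorticityDirection_slice_eq_of_isRotatedDSS (h : IsRotatedDSS c R u) (hc : c ≠ 0) (s : ℝ)
    (x : EuclideanSpace ℝ (Fin 3)) :
    vorticityDirection (curl (u s)) x =
      (R : EuclideanSpace ℝ (Fin 3) →L[ℝ] EuclideanSpace ℝ (Fin 3)).det •
        R (vorticityDirection (curl (u (s / c ^ 2))) (c⁻¹ • R.symm x)) := by
  rw [vorticityDirection_apply, vorticityDirection_apply, norm_curl_slice_eq_of_isRotatedDSS h hc s x,
    curl_slice_eq_of_isRotatedDSS h hc s x, LinearIsometryEquiv.map_smul, smul_smul, smul_smul]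
  by_cases hw : curl (u (s / c ^ 2)) (c⁻¹ • R.symm x) = 0
  · rw [hw, map_zero, smul_zero, smul_zero]
  · congr 1
    have hn : ‖curl (u (s / c ^ 2)) (c⁻¹ • R.symm x)‖ ≠ 0 := norm_ne_zero_iff.2 hw
    have hc2 : (c⁻¹) ^ 2 ≠ 0 := pow_ne_zero _ (inv_ne_zero hc)
    field_simp

/-- **The alignment defect is invariant across one period**: for two points `x, y`,
`‖ξ(s)(x) − ξ(s)(y)‖ = ‖ξ(s/c²)(c⁻¹R⁻¹x) − ξ(s/c²)(c⁻¹R⁻¹y)‖`. [cite: ConstantinFefferman1993, §1] -/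
theorem norm_vorticityDirection_sub_eq_of_isRotatedDSS (h : IsRotatedDSS c R u) (hc : c ≠ 0) (s : ℝ)
    (x y : EuclideanSpace ℝ (Fin 3)) :
    ‖vorticityDirection (curl (u s)) x - vorticityDirection (curl (u s)) y‖ =
      ‖vorticityDirection (curl (u (s / c ^ 2))) (c⁻¹ • R.symm x) -
        vorticityDirection (curl (u (s / c ^ 2))) (c⁻¹ • R.symm y)‖ := by
  rw [vorticityDirection_slice_eq_of_isRotatedDSS h hc s x,
    vorticityDirection_slice_eq_of_isRotatedDSS h hc s y, ← smul_sub, ← map_sub, norm_smul,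
    LinearIsometryEquiv.norm_map, Real.norm_eq_abs, abs_det_linearIsometryEquiv, one_mul]

/-- A vector field with values parallel to one vector `e`: its direction field is `e` wherever the
field is non-zero. [cite: ConstantinFefferman1993, §1] -/
theorem vorticityDirection_eq_of_eq_norm_smul {ω : EuclideanSpace ℝ (Fin 3) → EuclideanSpace ℝ (Fin 3)}
    {e : EuclideanSpace ℝ (Fin 3)} (h : ∀ x, ω x = ‖ω x‖ • e) {x : EuclideanSpace ℝ (Fin 3)}
    (hx : ω x ≠ 0) : vorticityDirection ω x = e := by
  have hn : ‖ω x‖ ≠ 0 := norm_ne_zero_iff.2 hx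
  calc vorticityDirection ω x = ‖ω x‖⁻¹ • ω x := rfl
    _ = ‖ω x‖⁻¹ • (‖ω x‖ • e) := congrArg (fun w => ‖ω x‖⁻¹ • w) (h x)
    _ = e := by rw [smul_smul, inv_mul_cancel₀ hn, one_smul]

/-- `ω(x) = ‖ω(x)‖ ξ(x)` at points where `ω(x) ≠ 0`. [cite: ConstantinFefferman1993, §1] -/
theorem eq_norm_smul_vorticityDirection {ω : EuclideanSpace ℝ (Fin 3) → EuclideanSpace ℝ (Fin 3)}
    {x : EuclideanSpace ℝ (Fin 3)} (hx : ω x ≠ 0) : ω x = ‖ω x‖ • vorticityDirection ω x := by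
  rw [vorticityDirection_apply, smul_smul, mul_inv_cancel₀ (norm_ne_zero_iff.2 hx), one_smul]

/-- A slice whose vorticity directions agree at all points of non-zero vorticity has
UNIDIRECTIONAL vorticity `ω = |ω| e`. [cite: GigaMiura2011, Prop. 2.2, proof (§2.1; HUPS preprint #956 pp. 7–8)] -/
theorem exists_eq_norm_smul_of_vorticityDirection_eq
    {ω : EuclideanSpace ℝ (Fin 3) → EuclideanSpace ℝ (Fin 3)}
    (h : ∀ x y, ω x ≠ 0 → ω y ≠ 0 → vorticityDirection ω x = vorticityDirection ω y) :
    ∃ e : EuclideanSpace ℝ (Fin 3), ∀ x, ω x = ‖ω x‖ • e := by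
  by_cases hz : ∀ x, ω x = 0
  · exact ⟨0, fun x => by rw [hz x, norm_zero, zero_smul]⟩
  push Not at hz
  obtain ⟨x₀, hx₀⟩ := hz
  refine ⟨vorticityDirection ω x₀, fun x => ?_⟩
  by_cases hx : ω x = 0
  · rw [hx, norm_zero, zero_smul]
  · rw [← h x x₀ hx hx₀]
    exact eq_norm_smul_vorticityDirection hx

/-- **Unidirectionality propagates across one period**: if `curl u(s/c²) = |curl u(s/c²)| e`
then `curl u(s) = |curl u(s)| (det R • R e)`. [cite: ChaeWolf2017, Def. 1.1] -/
theorem unidirectional_slice_of_isRotatedDSS (h : IsRotatedDSS c R u) (hc : c ≠ 0) {s : ℝ}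
    (hs : ∃ e : EuclideanSpace ℝ (Fin 3), ∀ x, curl (u (s / c ^ 2)) x = ‖curl (u (s / c ^ 2)) x‖ • e) :
    ∃ e : EuclideanSpace ℝ (Fin 3), ∀ x, curl (u s) x = ‖curl (u s) x‖ • e := by
  obtain ⟨e, he⟩ := hs
  refine ⟨(R : EuclideanSpace ℝ (Fin 3) →L[ℝ] EuclideanSpace ℝ (Fin 3)).det • R e, fun x => ?_⟩
  have hw := he (c⁻¹ • R.symm x)
  rw [norm_curl_slice_eq_of_isRotatedDSS h hc s x, curl_slice_eq_of_isRotatedDSS h hc s x]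
  conv_lhs => rw [hw]
  simp only [LinearIsometryEquiv.map_smul, smul_smul]
  congr 1
  ring

/-- **Unidirectional vorticity on the window `(−1, 0)` propagates to all `t < 0`** for a
rotated-DSS field with factor `c > 1` (every `t < 0` is `c²ᵏ s` with `s ∈ (−1, 0)`).
[cite: ChaeWolf2017, Def. 1.1] -/
theorem unidirectional_of_isRotatedDSS_of_Ioo (h : IsRotatedDSS c R u) (hc : 1 < c)
    (hU : ∀ s ∈ Ioo (-1 : ℝ) 0, ∃ e : EuclideanSpace ℝ (Fin 3), ∀ x,
      curl (u s) x = ‖curl (u s) x‖ • e) :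
    ∀ t < 0, ∃ e : EuclideanSpace ℝ (Fin 3), ∀ x, curl (u t) x = ‖curl (u t) x‖ • e := by
  have hc0 : c ≠ 0 := (zero_lt_one.trans hc).ne'
  have hc2 : 1 < c ^ 2 := by nlinarith
  -- induction on the number of periods
  have hP : ∀ k : ℕ, ∀ t < 0, -1 < t / (c ^ 2) ^ k →
      ∃ e : EuclideanSpace ℝ (Fin 3), ∀ x, curl (u t) x = ‖curl (u t) x‖ • e := by
    intro k
    induction k with
    | zero =>
      intro t ht h1
      rw [pow_zero, div_one] at h1
      exact hU t ⟨h1, ht⟩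
    | succ k ih =>
      intro t ht h1
      have ht' : t / c ^ 2 < 0 := div_neg_of_neg_of_pos ht (by positivity)
      have h1' : -1 < t / c ^ 2 / (c ^ 2) ^ k := by
        rw [div_div, ← pow_succ']; exact h1
      exact unidirectional_slice_of_isRotatedDSS h hc0 (ih (t / c ^ 2) ht' h1')
  intro t ht
  obtain ⟨k, hk⟩ := ((tendsto_pow_atTop_atTop_of_one_lt hc2).eventually_gt_atTop (-t)).exists
  refine hP k t ht ?_
  have hpos : 0 < (c ^ 2) ^ k := by positivity
  rw [lt_div_iff₀ hpos]
  linarith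

/-- **Self-improvement of Giga–Miura's continuous alignment (CA) under exact discrete
self-similarity.** Let `u` be rotated DSS with factor `c > 1` and suppose the vorticity directions
`ξ(s) = curl u(s)/|curl u(s)|` satisfy, on the window `s ∈ (−1, 0)` and above a threshold `d`,
`‖ξ(s)(x) − ξ(s)(y)‖ ≤ η(‖x − y‖)` with `η(r) → 0` as `r ↓ 0` (Giga–Miura's (CA), Theorem 1.3, for
the profile). Then for every `k`, above the threshold `d/c²ᵏ` the bound holds with `η(‖x − y‖/cᵏ)`
(pull the pair of points back `k` periods: magnitudes grow by `c²ᵏ`, distances shrink by `cᵏ`,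
the direction defect is unchanged). [cite: GigaMiura2011, Theorem 1.3 and Remark 1.4 (§1; HUPS preprint #956 p. 4)] -/
theorem continuousAlignment_iterate (h : IsRotatedDSS c R u) (hc : 1 < c) {d : ℝ} {η : ℝ → ℝ}
    (hCA : ∀ s ∈ Ioo (-1 : ℝ) 0, ∀ x y, d < ‖curl (u s) x‖ → d < ‖curl (u s) y‖ →
      ‖vorticityDirection (curl (u s)) x - vorticityDirection (curl (u s)) y‖ ≤ η ‖x - y‖)
    (k : ℕ) :
    ∀ s ∈ Ioo (-1 : ℝ) 0, ∀ x y, d < (c ^ 2) ^ k * ‖curl (u s) x‖ →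
      d < (c ^ 2) ^ k * ‖curl (u s) y‖ →
        ‖vorticityDirection (curl (u s)) x - vorticityDirection (curl (u s)) y‖ ≤
          η (‖x - y‖ / c ^ k) := by
  have hc0 : c ≠ 0 := (zero_lt_one.trans hc).ne'
  have hcpos : 0 < c := zero_lt_one.trans hc
  induction k with
  | zero =>
    intro s hs x y hx hy
    rw [pow_zero, one_mul] at hx hy
    rw [pow_zero, div_one]
    exact hCA s hs x y hx hy
  | succ k ih =>
    intro s hs x y hx hy
    -- pull back one period: time `s/c²`, points `c⁻¹R⁻¹x`, `c⁻¹R⁻¹y`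
    have hs' : s / c ^ 2 ∈ Ioo (-1 : ℝ) 0 := by
      have hc2 : 1 ≤ c ^ 2 := by nlinarith
      refine ⟨?_, div_neg_of_neg_of_pos hs.2 (by positivity)⟩
      rw [lt_div_iff₀ (by positivity)]
      nlinarith [hs.1]
    have hmag : ∀ z, ‖curl (u (s / c ^ 2)) (c⁻¹ • R.symm z)‖ = c ^ 2 * ‖curl (u s) z‖ := by
      intro z
      rw [norm_curl_slice_eq_of_isRotatedDSS h hc0 s z, ← mul_assoc, inv_pow, mul_inv_cancel₀
        (pow_ne_zero _ hc0), one_mul]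
    have hx' : d < (c ^ 2) ^ k * ‖curl (u (s / c ^ 2)) (c⁻¹ • R.symm x)‖ := by
      rw [hmag, ← mul_assoc, ← pow_succ]; exact hx
    have hy' : d < (c ^ 2) ^ k * ‖curl (u (s / c ^ 2)) (c⁻¹ • R.symm y)‖ := by
      rw [hmag, ← mul_assoc, ← pow_succ]; exact hy
    have hdist : ‖c⁻¹ • R.symm x - c⁻¹ • R.symm y‖ / c ^ k = ‖x - y‖ / c ^ (k + 1) := by
      rw [← smul_sub, ← map_sub, norm_smul, LinearIsometryEquiv.norm_map, Real.norm_eq_abs,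
        abs_of_pos (inv_pos.2 hcpos), pow_succ]
      field_simp
    have := ih (s / c ^ 2) hs' (c⁻¹ • R.symm x) (c⁻¹ • R.symm y) hx' hy'
    rwa [← norm_vorticityDirection_sub_eq_of_isRotatedDSS h hc0 s x y, hdist] at this

/-- **(CA) for an exactly rotated-DSS field forces parallel vorticity directions on every window
slice**: `ξ(s)(x) = ξ(s)(y)` whenever `curl u(s)(x) ≠ 0 ≠ curl u(s)(y)`, `s ∈ (−1, 0)` (let
`k → ∞` in `continuousAlignment_iterate`: the thresholds `d/c²ᵏ` are eventually passed and
`η(‖x − y‖/cᵏ) → 0`). [cite: GigaMiura2011, Theorem 1.3 and Remark 1.4 (§1; HUPS preprint #956 p. 4)] -/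
theorem vorticityDirection_eq_of_continuousAlignment (h : IsRotatedDSS c R u) (hc : 1 < c) {d : ℝ}
    {η : ℝ → ℝ} (hη : Tendsto η (𝓝[>] 0) (𝓝 0))
    (hCA : ∀ s ∈ Ioo (-1 : ℝ) 0, ∀ x y, d < ‖curl (u s) x‖ → d < ‖curl (u s) y‖ →
      ‖vorticityDirection (curl (u s)) x - vorticityDirection (curl (u s)) y‖ ≤ η ‖x - y‖)
    {s : ℝ} (hs : s ∈ Ioo (-1 : ℝ) 0) {x y : EuclideanSpace ℝ (Fin 3)} (hx : curl (u s) x ≠ 0)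
    (hy : curl (u s) y ≠ 0) :
    vorticityDirection (curl (u s)) x = vorticityDirection (curl (u s)) y := by
  by_cases hxy : x = y
  · rw [hxy]
  have hc2 : 1 < c ^ 2 := by nlinarith
  have hcpos : 0 < c := zero_lt_one.trans hc
  have hr : 0 < ‖x - y‖ := norm_pos_iff.2 (sub_ne_zero.2 hxy)
  -- thresholds are eventually passed
  have hgrow : Tendsto (fun k : ℕ => (c ^ 2) ^ k) atTop atTop := tendsto_pow_atTop_atTop_of_one_lt hc2
  have hX : ∀ᶠ k : ℕ in atTop, d < (c ^ 2) ^ k * ‖curl (u s) x‖ :=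
    (hgrow.atTop_mul_const (norm_pos_iff.2 hx)).eventually_gt_atTop d
  have hY : ∀ᶠ k : ℕ in atTop, d < (c ^ 2) ^ k * ‖curl (u s) y‖ :=
    (hgrow.atTop_mul_const (norm_pos_iff.2 hy)).eventually_gt_atTop d
  -- the rescaled distances tend to `0` from the right
  have hsmall : Tendsto (fun k : ℕ => ‖x - y‖ / c ^ k) atTop (𝓝[>] 0) := by
    refine tendsto_nhdsWithin_iff.2 ⟨?_, Eventually.of_forall fun k => div_pos hr (pow_pos hcpos k)⟩
    exact tendsto_const_nhds.div_atTop (tendsto_pow_atTop_atTop_of_one_lt hc)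
  have hηk : Tendsto (fun k : ℕ => η (‖x - y‖ / c ^ k)) atTop (𝓝 0) := hη.comp hsmall
  -- conclude: the defect is below every `κ > 0`
  rw [← sub_eq_zero, ← norm_le_zero_iff]
  refine le_of_forall_pos_lt_add fun κ hκ => ?_
  rw [zero_add]
  obtain ⟨k, hk1, hk2, hk3⟩ := (hX.and (hY.and (hηk.eventually (gt_mem_nhds hκ)))).exists
  exact (continuousAlignment_iterate h hc hCA k s hs x y hk1 hk2).trans_lt hk3

/-- **(CA) for an exactly rotated-DSS field with `c > 1` forces UNIDIRECTIONAL vorticity on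
every slice `t < 0`**: `curl u(t) = |curl u(t)| e(t)`. [cite: GigaMiura2011, Theorem 1.3 and Remark 1.4 (§1; HUPS preprint #956 p. 4)] -/
theorem unidirectional_of_continuousAlignment (h : IsRotatedDSS c R u) (hc : 1 < c) {d : ℝ}
    {η : ℝ → ℝ} (hη : Tendsto η (𝓝[>] 0) (𝓝 0))
    (hCA : ∀ s ∈ Ioo (-1 : ℝ) 0, ∀ x y, d < ‖curl (u s) x‖ → d < ‖curl (u s) y‖ →
      ‖vorticityDirection (curl (u s)) x - vorticityDirection (curl (u s)) y‖ ≤ η ‖x - y‖) :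
    ∀ t < 0, ∃ e : EuclideanSpace ℝ (Fin 3), ∀ x, curl (u t) x = ‖curl (u t) x‖ • e :=
  unidirectional_of_isRotatedDSS_of_Ioo h hc fun _ hs =>
    exists_eq_norm_smul_of_vorticityDirection_eq fun _ _ hx hy =>
      vorticityDirection_eq_of_continuousAlignment h hc hη hCA hs hx hy

end Algebra

end Summit.NavierStokesRegularity.AngularGalerkinLadderRotatedDSSVorticityDirection
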